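/-
R0 — NO PURE ADDITION IS EXACTLY TRANSPARENT ON A WINDOW (rh-split cell, seat rh-split-typer-3 g6, 2026-08-28; B33
«PRIME-WINDOW BLINDNESS», ε = 0 anatomy, the «pure addition» clause).  Proves the statement `NoExactPureAddition σ*`
typed (statement only) in `Theorems/Splittings/PrimeWindowBlindnessClass.lean` (rh-idea-4 g3, LINE-PrimeWindowBlindness.md
§3 (R0)), hence makes its corollary `not_primeWindowSmall_zero_of_R0` unconditional.  Kernel arithmetic on the model class
`Config` only: ζ-free, RH-free, std axioms.  Nothing here bears on the truth of RH.
-/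
import Summits.RiemannHypothesis.RiemannHypothesis.Theorems.Splittings.PrimeWindowBlindnessClass
import Summits.RiemannHypothesis.RiemannHypothesis.Theorems.Splittings.PrimeWindowFootprint
import Mathlib.MeasureTheory.Integral.DominatedConvergence
import Mathlib.MeasureTheory.Integral.IntervalIntegral.FundThmCalculus
import Mathlib.Analysis.Complex.RealDeriv
import Mathlib.Analysis.Complex.ExponentialBounds
import Mathlib.Analysis.SpecialFunctions.Trigonometric.DerivHyp
import HarnessLib

/-!
# R0: the window average of every off-line quadruple is positive

For one quadruple `{1/2 ± σ ± iγ}` of weight `m` the model term is `T(t) = quadTerm m κ t = 4 m Re[(cosh(κ t) - 1)/κ²]`,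
`κ = σ + iγ`.  Two explicit antiderivatives give the WINDOW AVERAGE in Taylor form,
`∫₀^δ T(t) dt = 4 m Re[(sinh(κδ) - κδ)/κ³] = 4 m ∫₀^δ ((δ - r)²/2) cosh(σ r) cos(γ r) dr`,
and a third one (the function `H = V sin(γ·)/γ + V' (cos(γ·) - 1)/γ²`, `V(r) = ((δ - r)²/2) cosh(σ r)`, which vanishes at
both ends) converts it into `(4 m/γ²) ∫₀^δ V''(r) (1 - cos(γ r)) dr`.  For `0 ≤ σ` and `σ δ ≤ 1/8` one has `V'' ≥ 1/4` on
`[0, δ]`, whence the atom bound `∫₀^δ T ≥ (m/γ²) (δ - sin(γδ)/γ) > 0` (`integral_quadTerm_ge`).  Summing over a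
configuration by dominated convergence (`Σ m/γ² < ∞`; the index type is countable because every term is positive) shows
that `Ψ_Z` cannot vanish identically on `[0, δ]`, for every `δ > 0` (shrink `δ` first): `noExactPureAddition`.
So an EXACTLY honest towered twin (`PrimeWindowSmall U 0 Z`) never exists for a pure addition — exact honesty forces theft
of true zeros (`not_primeWindowSmall_zero`), the `t → 0` germ being the obstruction, not the primes.
-/

noncomputable section

set_option linter.dupNamespace false

open Complex MeasureTheory Set intervalIntegral
open scoped Real Interval

namespace Summit.RiemannHypothesis.RiemannHypothesis.Theorems.Splittings.ScrewLatticeTower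

open Summit.RiemannHypothesis.RiemannHypothesis.Theorems.Splittings.ScrewLatticeWolff

/-! ## 1. Two complex antiderivatives: the window average in Taylor form -/

/-- Real part of the complex hyperbolic cosine: `Re cosh(x + iy) = cosh x cos y`. -/
theorem cosh_re_eq (z : ℂ) : (Complex.cosh z).re = Real.cosh z.re * Real.cos z.im := by
  conv_lhs => rw [← Complex.re_add_im z, Complex.cosh_add, Complex.cosh_mul_I, Complex.sinh_mul_I]
  simp [← Complex.ofReal_cosh, ← Complex.ofReal_cos, ← Complex.ofReal_sinh, ← Complex.ofReal_sin]

/-- `t ↦ quadTerm m κ t` is continuous. -/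
theorem continuous_quadTerm (m : ℝ) (κ : ℂ) : Continuous fun t : ℝ ↦ quadTerm m κ t := by
  unfold quadTerm
  fun_prop

/-- `d/dt sinh(κ t) = κ cosh(κ t)` along the real axis. -/
theorem hasDerivAt_sinh_mul (κ : ℂ) (t : ℝ) :
    HasDerivAt (fun y : ℝ ↦ Complex.sinh (κ * y)) (κ * Complex.cosh (κ * t)) t := by
  have h : HasDerivAt (fun z : ℂ ↦ Complex.sinh (κ * z)) (Complex.cosh (κ * t) * (κ * 1)) (t : ℂ) :=
    (Complex.hasDerivAt_sinh (κ * t)).comp (t : ℂ) ((hasDerivAt_id (t : ℂ)).const_mul κ)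
  simpa [mul_comm] using h.comp_ofReal

/-- `d/dt cosh(κ t) = κ sinh(κ t)` along the real axis. -/
theorem hasDerivAt_cosh_mul (κ : ℂ) (t : ℝ) :
    HasDerivAt (fun y : ℝ ↦ Complex.cosh (κ * y)) (κ * Complex.sinh (κ * t)) t := by
  have h : HasDerivAt (fun z : ℂ ↦ Complex.cosh (κ * z)) (Complex.sinh (κ * t) * (κ * 1)) (t : ℂ) :=
    (Complex.hasDerivAt_cosh (κ * t)).comp (t : ℂ) ((hasDerivAt_id (t : ℂ)).const_mul κ)
  simpa [mul_comm] using h.comp_ofReal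

/-- First antiderivative: `∫₀^δ (cosh(κt) - 1)/κ² dt = (sinh(κδ) - κδ)/κ³` (`κ ≠ 0`). -/
theorem integral_coshKernel {κ : ℂ} (hκ : κ ≠ 0) (δ : ℝ) :
    ∫ t in (0 : ℝ)..δ, (Complex.cosh (κ * t) - 1) / κ ^ 2 =
      (Complex.sinh (κ * δ) - κ * δ) / κ ^ 3 := by
  have hderiv : ∀ t ∈ uIcc (0 : ℝ) δ, HasDerivAt (fun y : ℝ ↦ (Complex.sinh (κ * y) / κ - y) / κ ^ 2)
      ((Complex.cosh (κ * t) - 1) / κ ^ 2) t := fun t _ ↦ by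
    have h := (((hasDerivAt_sinh_mul κ t).div_const κ).sub
      ((hasDerivAt_id t).ofReal_comp)).div_const (κ ^ 2)
    refine h.congr_deriv ?_
    push_cast
    field_simp
  have hcont : Continuous fun t : ℝ ↦ (Complex.cosh (κ * t) - 1) / κ ^ 2 := by fun_prop
  rw [integral_eq_sub_of_hasDerivAt hderiv (hcont.intervalIntegrable _ _)]
  simp only [Complex.ofReal_zero, mul_zero, Complex.sinh_zero, zero_div, sub_zero]
  field_simp

/-- Second antiderivative: `∫₀^δ ((δ - r)²/2) cosh(κ r) dr = (sinh(κδ) - κδ)/κ³` (`κ ≠ 0`), via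
`G(r) = ((δ-r)²/2) sinh(κr)/κ + (δ-r) cosh(κr)/κ² + sinh(κr)/κ³`. -/
theorem integral_taylorKernel {κ : ℂ} (hκ : κ ≠ 0) (δ : ℝ) :
    ∫ r in (0 : ℝ)..δ, (((δ - r) ^ 2 / 2 : ℝ) : ℂ) * Complex.cosh (κ * r) =
      (Complex.sinh (κ * δ) - κ * δ) / κ ^ 3 := by
  have hderiv : ∀ r ∈ uIcc (0 : ℝ) δ, HasDerivAt
      (fun y : ℝ ↦ (((δ - y) ^ 2 / 2 : ℝ) : ℂ) * Complex.sinh (κ * y) / κ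
        + ((δ - y : ℝ) : ℂ) * Complex.cosh (κ * y) / κ ^ 2 + Complex.sinh (κ * y) / κ ^ 3)
      ((((δ - r) ^ 2 / 2 : ℝ) : ℂ) * Complex.cosh (κ * r)) r := fun r _ ↦ by
    have h1 : HasDerivAt (fun y : ℝ ↦ (((δ - y) ^ 2 / 2 : ℝ) : ℂ)) (((-(δ - r)) : ℝ) : ℂ) r := by
      have : HasDerivAt (fun y : ℝ ↦ (δ - y) ^ 2 / 2) (-(δ - r)) r := by
        have h := (((hasDerivAt_id r).const_sub δ).pow 2).div_const 2
        refine h.congr_deriv ?_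
        simp; ring
      exact this.ofReal_comp
    have h2 : HasDerivAt (fun y : ℝ ↦ ((δ - y : ℝ) : ℂ)) ((-1 : ℝ) : ℂ) r := by
      have : HasDerivAt (fun y : ℝ ↦ δ - y) (-1) r := by
        simpa using (hasDerivAt_id r).const_sub δ
      exact this.ofReal_comp
    have h := (((h1.mul (hasDerivAt_sinh_mul κ r)).div_const κ).add
      ((h2.mul (hasDerivAt_cosh_mul κ r)).div_const (κ ^ 2))).add ((hasDerivAt_sinh_mul κ r).div_const (κ ^ 3))
    refine h.congr_deriv ?_
    push_cast
    field_simp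
    ring
  have hcont : Continuous fun r : ℝ ↦ (((δ - r) ^ 2 / 2 : ℝ) : ℂ) * Complex.cosh (κ * r) := by fun_prop
  rw [integral_eq_sub_of_hasDerivAt hderiv (hcont.intervalIntegrable _ _)]
  simp only [sub_self, Complex.ofReal_zero, mul_zero, Complex.sinh_zero, Complex.cosh_zero, zero_div,
    sub_zero, mul_one]
  push_cast
  field_simp
  ring

/-! ## 2. The positivity mechanism: `∫ V cos(γ·) = γ⁻² ∫ V'' (1 - cos(γ·))`, `V'' ≥ 1/4` -/

/-- The convexity constant: for `0 ≤ σ`, `0 ≤ r ≤ δ`, `σ δ ≤ 1/8`, the second derivative of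
`V(r) = ((δ - r)²/2) cosh(σ r)` is at least `1/4` (indeed `≥ 5/8`). -/
theorem taylorWeight_deriv2_ge {σ δ r : ℝ} (hσ : 0 ≤ σ) (hr : 0 ≤ r) (hrδ : r ≤ δ) (hX : σ * δ ≤ 1 / 8) :
    1 / 4 ≤ Real.cosh (σ * r) - 2 * (σ * (δ - r) * Real.sinh (σ * r))
      + (δ - r) ^ 2 / 2 * (σ ^ 2 * Real.cosh (σ * r)) := by
  have h1 : 1 ≤ Real.cosh (σ * r) := Real.one_le_cosh _
  have h2 : 0 ≤ (δ - r) ^ 2 / 2 * (σ ^ 2 * Real.cosh (σ * r)) := by positivity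
  have hσr : 0 ≤ σ * r := mul_nonneg hσ hr
  have hσr' : σ * r ≤ 1 := by nlinarith
  have hsinh0 : 0 ≤ Real.sinh (σ * r) := Real.sinh_nonneg_iff.2 hσr
  have hsinh : Real.sinh (σ * r) ≤ 3 / 2 := by
    rw [Real.sinh_eq]
    have he : Real.exp (σ * r) ≤ Real.exp 1 := Real.exp_le_exp.2 hσr'
    have he' : 0 < Real.exp (-(σ * r)) := Real.exp_pos _
    have h3 := Real.exp_one_lt_three
    linarith
  have ha0 : 0 ≤ σ * (δ - r) := mul_nonneg hσ (by linarith)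
  have ha : σ * (δ - r) ≤ 1 / 8 := by nlinarith
  have h3 : σ * (δ - r) * Real.sinh (σ * r) ≤ 1 / 8 * (3 / 2) := mul_le_mul ha hsinh hsinh0 (by norm_num)
  linarith

/-- **The averaged Taylor kernel is positive, quantitatively.**  For `0 ≤ σ`, `σ δ ≤ 1/8`, `0 ≤ δ`, `γ ≠ 0`:
`(1/(4γ²)) (δ - sin(γδ)/γ) ≤ ∫₀^δ ((δ - r)²/2) cosh(σ r) cos(γ r) dr`.  Mechanism: with `V(r) = ((δ - r)²/2) cosh(σ r)`
and `H = V sin(γ·)/γ + V' (cos(γ·) - 1)/γ²` one has `H' = V cos(γ·) - V'' (1 - cos(γ·))/γ²` and `H(0) = H(δ) = 0`, so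
`∫₀^δ V cos(γ·) = γ⁻² ∫₀^δ V'' (1 - cos(γ·)) ≥ γ⁻² ∫₀^δ (1/4)(1 - cos(γ·))` by `taylorWeight_deriv2_ge`. -/
theorem integral_taylorWeight_cos_ge {σ γ δ : ℝ} (hσ : 0 ≤ σ) (hγ : γ ≠ 0) (hδ : 0 ≤ δ) (hX : σ * δ ≤ 1 / 8) :
    1 / (4 * γ ^ 2) * (δ - Real.sin (γ * δ) / γ) ≤
      ∫ r in (0 : ℝ)..δ, (δ - r) ^ 2 / 2 * Real.cosh (σ * r) * Real.cos (γ * r) := by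
  -- derivatives of the weight `V` and of `V'`
  have hV : ∀ r : ℝ, HasDerivAt (fun y : ℝ ↦ (δ - y) ^ 2 / 2 * Real.cosh (σ * y))
      (-(δ - r) * Real.cosh (σ * r) + (δ - r) ^ 2 / 2 * (Real.sinh (σ * r) * σ)) r := fun r ↦ by
    have hl : HasDerivAt (fun y : ℝ ↦ σ * y) σ r := by simpa using (hasDerivAt_id r).const_mul σ
    have hq : HasDerivAt (fun y : ℝ ↦ (δ - y) ^ 2 / 2) (-(δ - r)) r := by
      have h := (((hasDerivAt_id r).const_sub δ).pow 2).div_const 2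
      exact h.congr_deriv (by simp; ring)
    exact hq.mul hl.cosh
  have hV' : ∀ r : ℝ, HasDerivAt
      (fun y : ℝ ↦ -(δ - y) * Real.cosh (σ * y) + (δ - y) ^ 2 / 2 * (Real.sinh (σ * y) * σ))
      (Real.cosh (σ * r) - 2 * (σ * (δ - r) * Real.sinh (σ * r))
        + (δ - r) ^ 2 / 2 * (σ ^ 2 * Real.cosh (σ * r))) r := fun r ↦ by
    have hl : HasDerivAt (fun y : ℝ ↦ σ * y) σ r := by simpa using (hasDerivAt_id r).const_mul σ
    have hq : HasDerivAt (fun y : ℝ ↦ (δ - y) ^ 2 / 2) (-(δ - r)) r := by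
      have h := (((hasDerivAt_id r).const_sub δ).pow 2).div_const 2
      exact h.congr_deriv (by simp; ring)
    have hlin : HasDerivAt (fun y : ℝ ↦ -(δ - y)) 1 r := by
      have h := (hasDerivAt_id' r).sub_const δ
      refine (h.congr_of_eventuallyEq ?_)
      exact Filter.Eventually.of_forall fun y ↦ by simp
    have h := (hlin.mul hl.cosh).add (hq.mul (hl.sinh.mul_const σ))
    exact h.congr_deriv (by ring)
  -- the function `H` and its derivative
  have hH : ∀ r : ℝ, HasDerivAt
      (fun y : ℝ ↦ (δ - y) ^ 2 / 2 * Real.cosh (σ * y) * Real.sin (γ * y) / γ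
        + (-(δ - y) * Real.cosh (σ * y) + (δ - y) ^ 2 / 2 * (Real.sinh (σ * y) * σ))
          * (Real.cos (γ * y) - 1) / γ ^ 2)
      ((δ - r) ^ 2 / 2 * Real.cosh (σ * r) * Real.cos (γ * r)
        - (Real.cosh (σ * r) - 2 * (σ * (δ - r) * Real.sinh (σ * r))
            + (δ - r) ^ 2 / 2 * (σ ^ 2 * Real.cosh (σ * r))) * (1 - Real.cos (γ * r)) / γ ^ 2) r := fun r ↦ by
    have hg : HasDerivAt (fun y : ℝ ↦ γ * y) γ r := by simpa using (hasDerivAt_id r).const_mul γ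
    have h := (((hV r).mul hg.sin).div_const γ).add (((hV' r).mul (hg.cos.sub_const 1)).div_const (γ ^ 2))
    exact h.congr_deriv (by field_simp; ring)
  -- integrability of the pieces (all continuous)
  have hc1 : Continuous fun r : ℝ ↦ (δ - r) ^ 2 / 2 * Real.cosh (σ * r) * Real.cos (γ * r) := by fun_prop
  have hc2 : Continuous fun r : ℝ ↦ (Real.cosh (σ * r) - 2 * (σ * (δ - r) * Real.sinh (σ * r))
      + (δ - r) ^ 2 / 2 * (σ ^ 2 * Real.cosh (σ * r))) * (1 - Real.cos (γ * r)) / γ ^ 2 := by fun_prop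
  have hc3 : Continuous fun r : ℝ ↦ 1 / 4 * (1 - Real.cos (γ * r)) / γ ^ 2 := by fun_prop
  -- `∫ (V cos - V''(1-cos)/γ²) = H δ - H 0 = 0`
  have hFTC := integral_eq_sub_of_hasDerivAt (a := 0) (b := δ) (fun r _ ↦ hH r)
    ((hc1.sub hc2).intervalIntegrable _ _)
  have hzero : (∫ r in (0 : ℝ)..δ, ((δ - r) ^ 2 / 2 * Real.cosh (σ * r) * Real.cos (γ * r)
      - (Real.cosh (σ * r) - 2 * (σ * (δ - r) * Real.sinh (σ * r))
          + (δ - r) ^ 2 / 2 * (σ ^ 2 * Real.cosh (σ * r))) * (1 - Real.cos (γ * r)) / γ ^ 2)) = 0 := by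
    rw [hFTC]
    simp
  rw [intervalIntegral.integral_sub (hc1.intervalIntegrable _ _) (hc2.intervalIntegrable _ _),
    sub_eq_zero] at hzero
  -- lower bound `V'' ≥ 1/4` under the integral
  have hmono : (∫ r in (0 : ℝ)..δ, 1 / 4 * (1 - Real.cos (γ * r)) / γ ^ 2) ≤
      ∫ r in (0 : ℝ)..δ, (Real.cosh (σ * r) - 2 * (σ * (δ - r) * Real.sinh (σ * r))
        + (δ - r) ^ 2 / 2 * (σ ^ 2 * Real.cosh (σ * r))) * (1 - Real.cos (γ * r)) / γ ^ 2 := by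
    refine intervalIntegral.integral_mono_on hδ (hc3.intervalIntegrable _ _) (hc2.intervalIntegrable _ _)
      fun r hr ↦ ?_
    have hγ2 : 0 < γ ^ 2 := by positivity
    have hcos : 0 ≤ 1 - Real.cos (γ * r) := by linarith [Real.cos_le_one (γ * r)]
    have hW := taylorWeight_deriv2_ge hσ hr.1 hr.2 hX
    exact div_le_div_of_nonneg_right (mul_le_mul_of_nonneg_right hW hcos) hγ2.le
  -- the explicit value of the minorant
  have hval : (∫ r in (0 : ℝ)..δ, 1 / 4 * (1 - Real.cos (γ * r)) / γ ^ 2) =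
      1 / (4 * γ ^ 2) * (δ - Real.sin (γ * δ) / γ) := by
    have hD : ∀ r ∈ uIcc (0 : ℝ) δ, HasDerivAt (fun y : ℝ ↦ 1 / (4 * γ ^ 2) * (y - Real.sin (γ * y) / γ))
        (1 / 4 * (1 - Real.cos (γ * r)) / γ ^ 2) r := fun r _ ↦ by
      have hg : HasDerivAt (fun y : ℝ ↦ γ * y) γ r := by simpa using (hasDerivAt_id r).const_mul γ
      have h := ((hasDerivAt_id r).sub (hg.sin.div_const γ)).const_mul (1 / (4 * γ ^ 2))
      exact h.congr_deriv (by field_simp)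
    rw [integral_eq_sub_of_hasDerivAt hD (hc3.intervalIntegrable _ _)]
    simp
  rw [hzero, ← hval]
  exact hmono

/-! ## 3. The atom bound -/

/-- **Window average of one quadruple (atom bound).**  For `m ≥ 0`, `κ = σ + iγ` with `0 ≤ σ`, `γ ≠ 0`, and a window
`[0, δ]` with `σ δ ≤ 1/8`:  `∫₀^δ quadTerm m κ t dt ≥ (m/γ²) (δ - sin(γδ)/γ)` — positive as soon as `m, δ > 0`. -/
theorem integral_quadTerm_ge {m δ : ℝ} {κ : ℂ} (hm : 0 ≤ m) (hσ : 0 ≤ κ.re) (hγ : κ.im ≠ 0) (hδ : 0 ≤ δ)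
    (hX : κ.re * δ ≤ 1 / 8) :
    m / κ.im ^ 2 * (δ - Real.sin (κ.im * δ) / κ.im) ≤ ∫ t in (0 : ℝ)..δ, quadTerm m κ t := by
  have hκ : κ ≠ 0 := fun h ↦ hγ (by rw [h]; simp)
  have hq_cont : Continuous fun t : ℝ ↦ (Complex.cosh (κ * t) - 1) / κ ^ 2 := by fun_prop
  have hqi : IntervalIntegrable (fun t : ℝ ↦ (Complex.cosh (κ * t) - 1) / κ ^ 2) volume 0 δ :=
    hq_cont.intervalIntegrable _ _
  -- `∫ T = 4 m · Re ∫ (cosh κt - 1)/κ²`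
  have h1 : (∫ t in (0 : ℝ)..δ, quadTerm m κ t) =
      4 * m * (∫ t in (0 : ℝ)..δ, (Complex.cosh (κ * t) - 1) / κ ^ 2).re := by
    have hre := Complex.reCLM.intervalIntegral_comp_comm hqi
    simp only [Complex.reCLM_apply] at hre
    unfold quadTerm
    rw [intervalIntegral.integral_const_mul, hre]
  -- `Re ∫ (cosh κt - 1)/κ² = ∫ ((δ-r)²/2) cosh(σ r) cos(γ r)`
  have h2 : (∫ t in (0 : ℝ)..δ, (Complex.cosh (κ * t) - 1) / κ ^ 2).re =
      ∫ r in (0 : ℝ)..δ, (δ - r) ^ 2 / 2 * Real.cosh (κ.re * r) * Real.cos (κ.im * r) := by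
    rw [integral_coshKernel hκ, ← integral_taylorKernel hκ]
    have hc : Continuous fun r : ℝ ↦ (((δ - r) ^ 2 / 2 : ℝ) : ℂ) * Complex.cosh (κ * r) := by fun_prop
    have hci : IntervalIntegrable (fun r : ℝ ↦ (((δ - r) ^ 2 / 2 : ℝ) : ℂ) * Complex.cosh (κ * r))
        volume 0 δ := hc.intervalIntegrable _ _
    have hre := Complex.reCLM.intervalIntegral_comp_comm hci
    simp only [Complex.reCLM_apply] at hre
    rw [← hre]
    refine intervalIntegral.integral_congr fun r _ ↦ ?_
    simp only [cosh_re_eq, Complex.mul_re, Complex.mul_im, Complex.ofReal_re, Complex.ofReal_im, mul_zero,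
      zero_mul, sub_zero, zero_add, mul_assoc]
  have h3 := integral_taylorWeight_cos_ge hσ hγ hδ hX
  rw [h1, h2]
  calc m / κ.im ^ 2 * (δ - Real.sin (κ.im * δ) / κ.im)
      = 4 * m * (1 / (4 * κ.im ^ 2) * (δ - Real.sin (κ.im * δ) / κ.im)) := by field_simp
    _ ≤ 4 * m * ∫ r in (0 : ℝ)..δ, (δ - r) ^ 2 / 2 * Real.cosh (κ.re * r) * Real.cos (κ.im * r) :=
        mul_le_mul_of_nonneg_left h3 (by positivity)

/-- The atom bound is strictly positive for `m > 0`, `γ ≠ 0`, `δ > 0` (`sin x < x` for `x > 0`). -/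
theorem atomBound_pos {m γ δ : ℝ} (hm : 0 < m) (hγ : γ ≠ 0) (hδ : 0 < δ) :
    0 < m / γ ^ 2 * (δ - Real.sin (γ * δ) / γ) := by
  have hγ2 : 0 < γ ^ 2 := by positivity
  refine mul_pos (div_pos hm hγ2) ?_
  rw [sub_pos]
  rcases lt_or_gt_of_ne hγ with h | h
  · have hx : 0 < -γ * δ := mul_pos (neg_pos.2 h) hδ
    have hs := Real.sin_lt hx
    rw [neg_mul, Real.sin_neg] at hs
    rw [div_lt_iff_of_neg h]
    linarith
  · have hs := Real.sin_lt (mul_pos h hδ)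
    rw [div_lt_iff₀ h]
    linarith

/-! ## 4. The configuration: no exactly transparent pure addition (R0) -/

/-- A summable family of positive reals has a countable index type. -/
theorem countable_of_summable_pos {ι : Type*} {f : ι → ℝ} (hf : Summable f) (hpos : ∀ i, 0 < f i) :
    Countable ι := by
  have h := hf.countable_support
  have hsupp : Function.support f = Set.univ := by
    ext i
    simp [(hpos i).ne']
  rw [hsupp] at h
  exact Set.countable_univ_iff.1 h

/-- **R0 — no pure addition is exactly transparent on any window** (`NoExactPureAddition σ*`, LINE-PrimeWindowBlindness
§3 (R0), typed in `PrimeWindowBlindnessClass`): a non-empty configuration of off-line quadruples with positive weights,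
abscissae in `[0, σ*]`, positive ordinates and `Σ m/γ² < ∞` has `Ψ_Z ≢ 0` on `[0, δ]` for every `δ > 0`.
Proof: shrink `δ` to `δ' = min δ (1/(8(σ*+1)))`; by dominated convergence (`Σ m/γ² < ∞`, countable index type)
`∫₀^{δ'} Ψ_Z = Σ_i ∫₀^{δ'} (T_{i,1} + T_{i,2}) ≥ Σ_i (atom bounds) > 0` (`integral_quadTerm_ge`, `atomBound_pos`),
while `Ψ_Z ≡ 0` on `[0, δ]` would make the integral vanish.  RH-free, ζ-free. -/
theorem noExactPureAddition (σs : ℝ) : NoExactPureAddition σs := by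
  intro Z hne hm hre him hsum δ hδ
  classical
  obtain ⟨i₀⟩ := hne
  have hσs : 0 ≤ σs := (hre i₀).1.trans (hre i₀).2.1
  -- shrink the window so that `σ δ' ≤ 1/8` for every abscissa
  set δ' : ℝ := min δ (1 / (8 * (σs + 1))) with hδ'
  have hδ'pos : 0 < δ' := lt_min hδ (by positivity)
  have hδ'le : δ' ≤ δ := min_le_left _ _
  have hX : ∀ σ : ℝ, 0 ≤ σ → σ ≤ σs → σ * δ' ≤ 1 / 8 := fun σ h0 h1 ↦ by
    have h2 : δ' ≤ 1 / (8 * (σs + 1)) := min_le_right _ _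
    calc σ * δ' ≤ σs * (1 / (8 * (σs + 1))) := mul_le_mul h1 h2 hδ'pos.le hσs
      _ ≤ 1 / 8 := by
          rw [mul_one_div, div_le_iff₀ (by positivity)]
          nlinarith
  by_contra hcon
  have hz : ∀ t ∈ Set.Icc (0 : ℝ) δ, Z.psi t = 0 := fun t ht ↦ by
    by_contra h
    exact hcon ⟨t, ht, h⟩
  -- the index type is countable (all terms of the convergent series are positive)
  haveI : Countable Z.ι := countable_of_summable_pos hsum fun i ↦ by
    have h1 := (hm i).1; have h2 := (hm i).2; have h3 := (him i).1; have h4 := (him i).2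
    positivity
  -- the family, its summable majorant on `[0, δ']`, and dominated convergence
  set F : Z.ι → ℝ → ℝ := fun i t ↦ quadTerm (Z.m₁ i) (Z.κ₁ i) t + quadTerm (Z.m₂ i) (Z.κ₂ i) t with hF
  set bound : Z.ι → ℝ → ℝ := fun i _ ↦
    8 * Real.exp (σs * δ') * (Z.m₁ i / (Z.κ₁ i).im ^ 2 + Z.m₂ i / (Z.κ₂ i).im ^ 2) with hbound
  have hFb : ∀ i t, |t| ≤ δ' → ‖F i t‖ ≤ bound i t := fun i t ht ↦ by
    have h1 := abs_quadTerm_le_window (hm i).1.le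
      (show |(Z.κ₁ i).re| ≤ σs by rw [abs_of_nonneg (hre i).1]; exact (hre i).2.1) (him i).1.ne' ht
    have h2 := abs_quadTerm_le_window (hm i).2.le
      (show |(Z.κ₂ i).re| ≤ σs by rw [abs_of_nonneg (hre i).2.2.1]; exact (hre i).2.2.2) (him i).2.ne' ht
    rw [Real.norm_eq_abs]
    calc |F i t| ≤ |quadTerm (Z.m₁ i) (Z.κ₁ i) t| + |quadTerm (Z.m₂ i) (Z.κ₂ i) t| := abs_add_le _ _
      _ ≤ _ := add_le_add h1 h2
      _ = bound i t := by simp only [hbound]; ring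
  have hIoc : ∀ t, t ∈ Ι (0 : ℝ) δ' → |t| ≤ δ' := fun t ht ↦ by
    rw [Set.uIoc_of_le hδ'pos.le] at ht
    rw [abs_of_pos ht.1]
    exact ht.2
  have hF_meas : ∀ i, AEStronglyMeasurable (F i) (volume.restrict (Ι (0 : ℝ) δ')) := fun i ↦
    ((continuous_quadTerm _ _).add (continuous_quadTerm _ _)).aestronglyMeasurable
  have h_bound : ∀ i, ∀ᵐ t ∂volume, t ∈ Ι (0 : ℝ) δ' → ‖F i t‖ ≤ bound i t := fun i ↦
    ae_of_all _ fun t ht ↦ hFb i t (hIoc t ht)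
  have bound_summable : ∀ᵐ t ∂volume, t ∈ Ι (0 : ℝ) δ' → Summable fun i ↦ bound i t := by
    refine ae_of_all _ fun t _ ↦ ?_
    simp only [hbound]
    exact hsum.mul_left _
  have bound_integrable : IntervalIntegrable (fun t ↦ ∑' i, bound i t) volume (0 : ℝ) δ' := by
    simp only [hbound]
    exact intervalIntegrable_const
  have h_lim : ∀ᵐ t ∂volume, t ∈ Ι (0 : ℝ) δ' → HasSum (fun i ↦ F i t) (Z.psi t) := by
    refine ae_of_all _ fun t ht ↦ ?_
    have hs : Summable fun i ↦ F i t :=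
      Summable.of_norm_bounded (hsum.mul_left (8 * Real.exp (σs * δ'))) fun i ↦ hFb i t (hIoc t ht)
    have hpsi : Z.psi t = ∑' i, F i t := rfl
    rw [hpsi]
    exact hs.hasSum
  have hDCT := intervalIntegral.hasSum_integral_of_dominated_convergence bound hF_meas h_bound bound_summable
    bound_integrable h_lim
  -- the window integral of `Ψ_Z` vanishes
  have hint0 : (∫ t in (0 : ℝ)..δ', Z.psi t) = 0 := by
    rw [intervalIntegral.integral_congr (g := fun _ ↦ (0 : ℝ)) fun t ht ↦ ?_]
    · simp
    · rw [Set.uIcc_of_le hδ'pos.le] at ht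
      exact hz t ⟨ht.1, ht.2.trans hδ'le⟩
  rw [hint0] at hDCT
  -- but every term is at least its (positive) atom bound
  have hterm : ∀ i, Z.m₁ i / (Z.κ₁ i).im ^ 2 * (δ' - Real.sin ((Z.κ₁ i).im * δ') / (Z.κ₁ i).im) +
      Z.m₂ i / (Z.κ₂ i).im ^ 2 * (δ' - Real.sin ((Z.κ₂ i).im * δ') / (Z.κ₂ i).im) ≤
        ∫ t in (0 : ℝ)..δ', F i t := fun i ↦ by
    have h1 := integral_quadTerm_ge (hm i).1.le (hre i).1 (him i).1.ne' hδ'pos.le (hX _ (hre i).1 (hre i).2.1)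
    have h2 := integral_quadTerm_ge (hm i).2.le (hre i).2.2.1 (him i).2.ne' hδ'pos.le
      (hX _ (hre i).2.2.1 (hre i).2.2.2)
    simp only [hF]
    rw [intervalIntegral.integral_add ((continuous_quadTerm _ _).intervalIntegrable _ _)
      ((continuous_quadTerm _ _).intervalIntegrable _ _)]
    exact add_le_add h1 h2
  have hpos : ∀ i, 0 < Z.m₁ i / (Z.κ₁ i).im ^ 2 * (δ' - Real.sin ((Z.κ₁ i).im * δ') / (Z.κ₁ i).im) +
      Z.m₂ i / (Z.κ₂ i).im ^ 2 * (δ' - Real.sin ((Z.κ₂ i).im * δ') / (Z.κ₂ i).im) := fun i ↦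
    add_pos (atomBound_pos (hm i).1 (him i).1.ne' hδ'pos) (atomBound_pos (hm i).2 (him i).2.ne' hδ'pos)
  have hle := le_hasSum hDCT i₀ fun j _ ↦ (hpos j).le.trans (hterm j)
  linarith [hpos i₀, hterm i₀]

/-- Hence (with `not_primeWindowSmall_zero_of_R0` of `PrimeWindowBlindnessClass`, now unconditional): an EXACTLY honest
towered twin is never a pure addition — `PrimeWindowSmall U 0 Z` fails for every admissible non-empty `Z`, `U > 0`. -/
theorem not_primeWindowSmall_zero {σs : ℝ} (Z : Config) (hne : Nonempty Z.ι) (hm : ∀ i, 0 < Z.m₁ i ∧ 0 < Z.m₂ i)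
    (hre : ∀ i, 0 ≤ (Z.κ₁ i).re ∧ (Z.κ₁ i).re ≤ σs ∧ 0 ≤ (Z.κ₂ i).re ∧ (Z.κ₂ i).re ≤ σs)
    (him : ∀ i, 0 < (Z.κ₁ i).im ∧ 0 < (Z.κ₂ i).im)
    (hsum : Summable (fun i ↦ Z.m₁ i / (Z.κ₁ i).im ^ 2 + Z.m₂ i / (Z.κ₂ i).im ^ 2))
    {U : ℝ} (hU : 0 < U) : ¬ PrimeWindowSmall U 0 Z :=
  not_primeWindowSmall_zero_of_R0 (noExactPureAddition σs) Z hne hm hre him hsum hU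

end Summit.RiemannHypothesis.RiemannHypothesis.Theorems.Splittings.ScrewLatticeTower

end
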